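import Summits.CriticalPhenomena.SAWScalingLimit.Theorems.SAWReversalUpgradeFaithfulOfNoReturnModelPieces
import HarnessLib

/-!
# Route `SAWReversalUpgrade`, support `FaithfulOfNoReturn` (stmt-CriticalPhenomena-18008):
# the model curve, II — the exit piece

Helper file (8 of several) for the proof of
`Summit.CriticalPhenomena.SAWScalingLimit.Theses.SAWReversalUpgrade.FaithfulOfNoReturn`.

The exit piece of the model curve runs from the exit crossing `attZ vMid` to `b`:
* if the polyline hits `b` (`R (firstB b R) = b`) it is the constant path at `b = attZ vMid`;
* otherwise it is the exit ray `t ↦ Φ ((rEx / (1 - t)) · qEx)`, `t ∈ [0, 1)`, completed by `b` at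
  `t = 1` (continuous there because `Φ → b` at infinity).
`exists_exitPath` records: flatness, range `= (exit image of the route's attSet) ∪ {b}`, the
junction property (it meets `midSet` only at `attZ vMid`), and `r₀/4`-closeness to `b`.
-/

noncomputable section

open Set Filter Metric Complex Function
open scoped Topology unitInterval
open UpperHalfPlane (upperHalfPlaneSet)
open Literature.Probability.RandomPlanarGeometry

namespace Summit.CriticalPhenomena.SAWScalingLimit.Theorems

namespace FaithfulAttach

open AttachReversal

variable {D : DobrushinDomain} {φ : ConformalEquiv upperHalfPlaneSet D.carrier} {e : ℝ} {R : ℝ → ℂ}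
  (hφ : D.IsChordalUniformizing φ) (he0 : 0 < e) (he1 : e ≤ 1 / 2)
  (hRc : Continuous R) (hRmem : ∀ u, R u ∈ closure D.carrier) (hR1 : R 1 ∈ D.carrier)
  (hij : lastA (D.pt 0) R ≤ firstB (D.pt 1) R)

include hφ he0 he1 hRc hRmem hR1 hij in
/-- **The exit ray completed by `b` is continuous** (regime `R j ≠ b`): the map
`t ↦ if t < 1 then Φ ((rEx / (1 - t)) · qEx) else b` on `unitInterval`. -/
theorem continuous_exitFun (hjb : R (firstB (D.pt 1) R) ≠ D.pt 1) :
    Continuous fun t : I => if (t : ℝ) < 1 then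
      φ.boundaryExtension (((rEx (D.pt 0) (D.pt 1) φ.boundaryExtension e R / (1 - (t : ℝ)) : ℝ) : ℂ) *
        qEx (D.pt 1) φ.boundaryExtension e R) else D.pt 1 := by
  set r := rEx (D.pt 0) (D.pt 1) φ.boundaryExtension e R with hr
  set q := qEx (D.pt 1) φ.boundaryExtension e R with hq
  have hw : 0 < q.im := im_qEx_pos hφ he0 he1 hRc hR1 hjb
  have hq0 : 0 < ‖q‖ := norm_pos_iff.2 fun h => by rw [h, zero_im] at hw; exact lt_irrefl _ hw
  obtain ⟨hr1, -, -⟩ := rEx_facts hφ he0 he1 hRc hRmem hR1 hij hjb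
  have hr0 : 0 < r := zero_lt_one.trans_le hr1
  refine continuous_iff_continuousAt.2 fun t => ?_
  by_cases ht : (t : ℝ) < 1
  · -- before time `1`: the completed ray is locally the ray
    have hopen : IsOpen {t' : I | (t' : ℝ) < 1} := isOpen_lt continuous_subtype_val continuous_const
    have heq : (fun t' : I => if (t' : ℝ) < 1 then
        φ.boundaryExtension (((r / (1 - (t' : ℝ)) : ℝ) : ℂ) * q) else D.pt 1) =ᶠ[𝓝 t]
        fun t' : I => φ.boundaryExtension (((r / (1 - (t' : ℝ)) : ℝ) : ℂ) * q) :=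
      Filter.eventuallyEq_of_mem (hopen.mem_nhds ht) fun t' ht' => if_pos ht'
    refine (continuousAt_congr heq).2 ?_
    have hx0 : 0 < r / (1 - (t : ℝ)) := div_pos hr0 (sub_pos.2 ht)
    have hray : ContinuousAt (fun x : ℝ => φ.boundaryExtension ((x : ℂ) * q)) (r / (1 - (t : ℝ))) :=
      (continuousOn_ray hw).continuousAt (Ici_mem_nhds hx0)
    have hpar : ContinuousAt (fun t' : I => r / (1 - (t' : ℝ))) t :=
      continuousAt_const.div (continuousAt_const.sub continuous_subtype_val.continuousAt)
        (sub_pos.2 ht).ne'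
    show ContinuousAt ((fun x : ℝ => φ.boundaryExtension ((x : ℂ) * q)) ∘ (fun t' : I => r / (1 - (t' : ℝ)))) t
    exact ContinuousAt.comp_of_eq hray hpar rfl
  · -- at time `1`: the ray tends to `b`
    have ht1 : (t : ℝ) = 1 := le_antisymm t.2.2 (not_lt.1 ht)
    rw [Metric.continuousAt_iff]
    intro κ hκ
    obtain ⟨M, hM, hfar⟩ := exists_norm_le_dist_bext_lt hφ hκ
    refine ⟨r * ‖q‖ / M, by positivity, fun t' ht' => ?_⟩
    rw [if_neg ht]
    by_cases ht'1 : (t' : ℝ) < 1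
    · rw [if_pos ht'1]
      have hdist : 1 - (t' : ℝ) < r * ‖q‖ / M := by
        rw [Subtype.dist_eq, Real.dist_eq, ht1, abs_sub_comm, abs_of_nonneg (sub_nonneg.2 t'.2.2)] at ht'
        exact ht'
      have hpos : 0 < 1 - (t' : ℝ) := sub_pos.2 ht'1
      refine hfar _ (ray_im_nonneg hw.le (div_pos hr0 hpos).le) ?_
      rw [norm_ray _ (div_pos hr0 hpos).le, div_mul_eq_mul_div, le_div_iff₀ hpos]
      rw [lt_div_iff₀ hM] at hdist
      linarith
    · rw [if_neg ht'1, dist_self]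
      exact hκ

include hφ he0 he1 hRc hRmem hR1 hij in
/-- **The exit piece of the model curve.** A path from the exit crossing `attZ vMid` to `b` which is
flat, has range `(exit image) ∪ {b}`, meets `midSet` only at its starting point, and stays
`r₀/4`-close to `b`. -/
theorem exists_exitPath {r₀ : ℝ} (hr₀ : 0 < r₀)
    (hex : ∀ z : ℂ, 0 ≤ z.im → ‖hinv φ.boundaryExtension (R 1)‖ ≤ ‖z‖ →
      dist (φ.boundaryExtension z) (D.pt 1) < r₀ / 4) :
    ∃ γ : Path (attZ (D.pt 1) φ.boundaryExtension e R (vMid (D.pt 0) (D.pt 1) φ.boundaryExtension e R))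
      (D.pt 1),
      (Curve.ofPath γ).IsFlat ∧
      Set.range γ = (fun t : ℝ => φ.boundaryExtension ((t : ℂ) * qEx (D.pt 1) φ.boundaryExtension e R)) ''
        {t | rEx (D.pt 0) (D.pt 1) φ.boundaryExtension e R ≤ t ∧ R (firstB (D.pt 1) R) ≠ D.pt 1} ∪
        {D.pt 1} ∧
      (∀ t, γ t ∈ midSet (D.pt 0) (D.pt 1) φ.boundaryExtension e R →
        γ t = attZ (D.pt 1) φ.boundaryExtension e R (vMid (D.pt 0) (D.pt 1) φ.boundaryExtension e R)) ∧
      (∀ t, dist (γ t) (D.pt 1) < r₀ / 4) := by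
  by_cases hjb : R (firstB (D.pt 1) R) = D.pt 1
  · -- the polyline hits `b`: constant exit piece
    have hZv := attZ_vMid_of_eq hφ he0 he1 hRmem hij hjb
    refine ⟨(Path.refl (D.pt 1)).cast hZv rfl, isFlat_ofPath_of_const fun t => hZv.symm, ?_, ?_, ?_⟩
    · have hempty : {t : ℝ | rEx (D.pt 0) (D.pt 1) φ.boundaryExtension e R ≤ t ∧
          R (firstB (D.pt 1) R) ≠ D.pt 1} = ∅ := by
        ext t
        simp only [mem_setOf_eq, mem_empty_iff_false, iff_false, not_and, not_not]
        exact fun _ => hjb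
      rw [hempty, image_empty, empty_union]
      ext x
      simp only [mem_range, mem_singleton_iff]
      exact ⟨fun ⟨_, h⟩ => h.symm, fun h => ⟨0, h.symm⟩⟩
    · intro t _
      exact hZv.symm
    · intro t
      change dist (D.pt 1) (D.pt 1) < r₀ / 4
      rw [dist_self]
      positivity
  · -- the exit ray is used
    set r := rEx (D.pt 0) (D.pt 1) φ.boundaryExtension e R with hr
    set q := qEx (D.pt 1) φ.boundaryExtension e R with hq
    have hw : 0 < q.im := im_qEx_pos hφ he0 he1 hRc hR1 hjb
    have hq0 : 0 < ‖q‖ := norm_pos_iff.2 fun h => by rw [h, zero_im] at hw; exact lt_irrefl _ hw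
    obtain ⟨hr1, -, hnotM⟩ := rEx_facts hφ he0 he1 hRc hRmem hR1 hij hjb
    obtain ⟨-, hZv, -⟩ := vMid_facts_of_ne hφ he0 he1 hRc hRmem hR1 hij hjb
    have hr0 : 0 < r := zero_lt_one.trans_le hr1
    have hcont := continuous_exitFun hφ he0 he1 hRc hRmem hR1 hij hjb
    let γ : Path (attZ (D.pt 1) φ.boundaryExtension e R (vMid (D.pt 0) (D.pt 1) φ.boundaryExtension e R))
        (D.pt 1) :=
      { toFun := fun t : I => if (t : ℝ) < 1 then
          φ.boundaryExtension (((r / (1 - (t : ℝ)) : ℝ) : ℂ) * q) else D.pt 1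
        continuous_toFun := hcont
        source' := by
          show (if ((0 : I) : ℝ) < 1 then φ.boundaryExtension (((r / (1 - ((0 : I) : ℝ)) : ℝ) : ℂ) * q)
            else D.pt 1) = _
          rw [if_pos (show ((0 : I) : ℝ) < 1 by norm_num), show (r / (1 - ((0 : I) : ℝ)) : ℝ) = r by simp]
          exact hZv.symm
        target' := if_neg (lt_irrefl (1 : ℝ)) }
    have hγ : ∀ t : I, γ t = if (t : ℝ) < 1 then
        φ.boundaryExtension (((r / (1 - (t : ℝ)) : ℝ) : ℂ) * q) else D.pt 1 := fun t => rfl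
    -- parameters along the ray
    have hpar : ∀ t : I, (t : ℝ) < 1 → r ≤ r / (1 - (t : ℝ)) ∧ 0 ≤ r / (1 - (t : ℝ)) := fun t ht => by
      have hpos : 0 < 1 - (t : ℝ) := sub_pos.2 ht
      refine ⟨?_, (div_pos hr0 hpos).le⟩
      rw [le_div_iff₀ hpos]
      nlinarith [t.2.1]
    refine ⟨γ, ?_, ?_, ?_, ?_⟩
    · -- flatness from injectivity
      refine isFlat_ofPath_of_injective fun t t' htt' => ?_
      rw [hγ, hγ] at htt'
      by_cases ht : (t : ℝ) < 1
      · by_cases ht' : (t' : ℝ) < 1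
        · rw [if_pos ht, if_pos ht'] at htt'
          have h1 := injOn_ray hw (hpar t ht).2 (hpar t' ht').2 htt'
          have hne : (1 - (t : ℝ)) ≠ 0 := (sub_pos.2 ht).ne'
          have hne' : (1 - (t' : ℝ)) ≠ 0 := (sub_pos.2 ht').ne'
          rw [div_eq_div_iff hne hne'] at h1
          have := mul_left_cancel₀ hr0.ne' h1
          exact Subtype.ext (by linarith)
        · rw [if_pos ht, if_neg ht'] at htt'
          exact absurd htt' (ray_ne_pt_one hφ hw (hpar t ht).2)
      · by_cases ht' : (t' : ℝ) < 1
        · rw [if_neg ht, if_pos ht'] at htt'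
          exact absurd htt'.symm (ray_ne_pt_one hφ hw (hpar t' ht').2)
        · exact Subtype.ext ((le_antisymm t.2.2 (not_lt.1 ht)).trans (le_antisymm t'.2.2 (not_lt.1 ht')).symm)
    · -- range
      ext x
      simp only [mem_range, mem_union, mem_image, mem_setOf_eq, mem_singleton_iff]
      constructor
      · rintro ⟨t, rfl⟩
        rw [hγ]
        by_cases ht : (t : ℝ) < 1
        · rw [if_pos ht]
          exact Or.inl ⟨_, ⟨(hpar t ht).1, hjb⟩, rfl⟩
        · rw [if_neg ht]
          exact Or.inr rfl
      · rintro (⟨y, ⟨hy, -⟩, rfl⟩ | rfl)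
        · have hy0 : 0 < y := hr0.trans_le hy
          have hmem : 1 - r / y ∈ I := ⟨sub_nonneg.2 ((div_le_one hy0).2 hy),
            sub_le_self _ (div_pos hr0 hy0).le⟩
          refine ⟨⟨1 - r / y, hmem⟩, ?_⟩
          rw [hγ]
          have hlt : ((⟨1 - r / y, hmem⟩ : I) : ℝ) < 1 := by
            show 1 - r / y < 1
            linarith [div_pos hr0 hy0]
          rw [if_pos hlt]
          congr 3
          show r / (1 - (1 - r / y)) = y
          rw [sub_sub_cancel, div_div_eq_mul_div, mul_div_cancel_left₀ _ hr0.ne']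
        · exact ⟨1, by rw [hγ]; exact if_neg (lt_irrefl (1:ℝ))⟩
    · -- junction property
      intro t htM
      rw [hγ] at htM ⊢
      by_cases ht : (t : ℝ) < 1
      · rw [if_pos ht] at htM ⊢
        rcases (hpar t ht).1.eq_or_lt with heq | hlt
        · rw [← heq]
          exact hZv.symm
        · exact absurd htM (hnotM _ hlt)
      · rw [if_neg ht] at htM
        exact absurd (apply_firstB_eq_of_pt_one_mem_midSet hφ he0 he1 hRc hRmem htM) hjb
    · -- closeness to `b`
      intro t
      rw [hγ]
      by_cases ht : (t : ℝ) < 1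
      · rw [if_pos ht]
        refine hex _ (ray_im_nonneg hw.le (hpar t ht).2) ?_
        rw [norm_ray _ (hpar t ht).2, ← norm_qEx hRc hjb]
        exact le_mul_of_one_le_left (norm_nonneg _) (hr1.trans (hpar t ht).1)
      · rw [if_neg ht, dist_self]
        positivity

end FaithfulAttach

end Summit.CriticalPhenomena.SAWScalingLimit.Theorems
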